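import Literature.AlgebraicGeometry.Motives.HilbertImageInGrassmannianUniversalFamily
import Literature.AlgebraicGeometry.Motives.GrassmannianQuotientIsoPullback
import HarnessLib

/-!
# The Hilbert scheme of `𝐏(ι)` in its Grassmannian: `j` classifies the universal family, and the Hilbert–Plücker class
# `[j^*𝒬_k] = [det p_*𝒪_{Z_H}(d)]`

Layer `Literature/AlgebraicGeometry/Motives`, namespace `Literature.AlgebraicGeometry.Motives`.  THEOREMS ONLY (no definition, no named fact, no
instance, no notation, no `sorry`).  Cell `hodgecm-mathlib` (D-0151), floor-0 programme P1, sub-line F-13 `Lines/F13PluckerProducer` (shape (β′)),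
stub P2b `stub_PLhilbClass`: §0–§1 are B-p03 (g19)'s seed `HilbertImagePluckerSeed.P2b-section0` (sha16 577e9800, written «for B-p10's
`Motives/HilbertImagePluckerClass`», folded here zero-name with its docstrings), §2 is the class identity and the HEAD (B-p11 (g20)).  Count-neutral
capital: HC_CM is proved only modulo the 7 printed citations until rung 0 closes — nothing here bears on a summit statement.

Over ★ ⑦b ED. 4 `Motives/HilbertImageInGrassmannianUniversalFamily` ([Mumford1966CurvesSurface] Lecture 15: the Hilbert scheme `H = Hilb^P_{𝐏(ι)}`
IMMERSED by `j` in the Grassmannian of rank-`k` quotients of `ℤ^{(Mon_d)}`, with its universal flat family `Z_H ⊂ 𝐏(ι; H)` representing the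
embedded flat families with direct images of rank `P(e)`, `e ≥ e₀`):

* §0 `exists_universal_flat_family_classified_of` (H2′) — ★ `exists_universal_flat_family_of` with two more conjuncts on the SAME witnesses:
  the square `Z_H = Z_K ×_{𝐏(ι; Gr)} 𝐏(ι; H)` over `𝐏(j)`, and «`j` CLASSIFIES `Z_H` through the monomial sections of `𝒪_{Z_H}(d)`»
  (`(pointsEquiv j)|_V = ker θ_V(p_*𝒪_{Z_H}(d), μ)` on every affine `V ⊆ H`; ★ `eq_of_isPullback_of_classifies`).
* §1 `exists_grassmannianImmersion_universal_flat_family_classified` — the closed head replaying ★ ed. 4's assembly (`d := B(P)⁺ + e₁`, `k := R d`).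
* §2 **`exists_grassmannianImmersion_universal_flat_family_detClass`**, HEAD **`hilbertPluckerClass`** (the stub letter, `∀ ⦃ι⦄ [Finite ι]`) — the
  same data with `e₁ ≤ d` and THE HILBERT–PLÜCKER CLASS `∃ hQ hP, detClass (j^*𝒬_k) = detClass (p_*𝒪_{Z_H}(d))` in `Ȟ¹(H, 𝒪^×)`
  ([MumfordFogartyKirwan1994] Ch. 0 §5 (c), Prop. 7.4; FGA 221 §4: `j` is the Grassmannian point of `𝒪_H ⊗ Sym^d ↠ p_*𝒪_{Z_H}(d)`): the
  monomial map `𝒪_H^{(Mon_d)} → p_*𝒪_{Z_H}(d)` is an epimorphism (★ ③b `epi_of_app_freeSectionOn_eq_monomialSection`) classified by `j` (§1), so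
  `p_*𝒪_{Z_H}(d) ≅ j^*𝒬_k` (★ `Grassmannian.exists_iso_pullback_universalQuotient`, [GortzWedhorn2020] (8.4)), both finite locally free of rank
  `k` (★ ③b `hasRank_pushforward_twistMod_of_hasRank_twists`, ★ `hasRank_pullback_universalQuotient`), and `[det]` is an isomorphism invariant
  (★ `detClass_eq_of_iso`).

## References
* [Mumford1966CurvesSurface] D. Mumford, *Lectures on Curves on an Algebraic Surface* (1966), Lecture 15 (III.)–(V.) (pp. 106–108).
* [MumfordFogartyKirwan1994] D. Mumford, J. Fogarty, F. Kirwan, *Geometric Invariant Theory*, 3rd ed. (1994), Ch. 0 §5 (c) (p. 23); Ch. 7 §2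
  Prop. 7.4 (p. 135).
* [GortzWedhorn2020] U. Görtz, T. Wedhorn, *Algebraic Geometry I*, 2nd ed. (2020), (8.4) (pp. 213–215).
-/

noncomputable section
set_option backward.isDefEq.respectTransparency false

open CategoryTheory Opposite TensorProduct TopologicalSpace AlgebraicGeometry Limits
open Literature.AlgebraicGeometry.Motives

namespace Literature.AlgebraicGeometry.Motives

open Literature.AlgebraicGeometry.Modules Literature.AlgebraicGeometry.Motives.Grassmannian
open Polynomial Literature.Algebra.Homology.LaurentCech CategoryTheory.Abelian

section Primed

variable {ι : Type} (d k : ℕ)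
  [(grassmannianSheaf ((Fin d → Fin (Nat.card ι + 1)) →₀ ℤ) k).obj.IsRepresentable]
  (φGr : freeModule (grassmannianScheme ((Fin d → Fin (Nat.card ι + 1)) →₀ ℤ) k) (Fin d → Fin (Nat.card ι + 1)) ⟶
    (Scheme.Modules.pushforward (Morphisms.projectiveSpaceFst ι
      (grassmannianScheme ((Fin d → Fin (Nat.card ι + 1)) →₀ ℤ) k))).obj
      (SerreTwist.twistMod (pullback.snd (terminal.from (grassmannianScheme ((Fin d → Fin (Nat.card ι + 1)) →₀ ℤ) k))
        (terminal.from (Morphisms.projectiveSpaceInt ι)))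
        (unitModule (Morphisms.projectiveSpace ι (grassmannianScheme ((Fin d → Fin (Nat.card ι + 1)) →₀ ℤ) k))) d))
  (hφGr : ∀ (w : Fin d → Fin (Nat.card ι + 1)) (V : (grassmannianScheme ((Fin d → Fin (Nat.card ι + 1)) →₀ ℤ) k).Opens),
    φGr.app V (freeSectionOn _ w V) =
    (SerreTwist.twistMod (pullback.snd (terminal.from (grassmannianScheme ((Fin d → Fin (Nat.card ι + 1)) →₀ ℤ) k))
        (terminal.from (Morphisms.projectiveSpaceInt ι)))
        (unitModule (Morphisms.projectiveSpace ι (grassmannianScheme ((Fin d → Fin (Nat.card ι + 1)) →₀ ℤ) k))) d).presheaf.map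
      (homOfLE (le_top : (Morphisms.projectiveSpaceFst ι (grassmannianScheme ((Fin d → Fin (Nat.card ι + 1)) →₀ ℤ) k)) ⁻¹ᵁ V ≤
        ⊤)).op
      (SerreTwist.monomialSection (pullback.snd (terminal.from (grassmannianScheme ((Fin d → Fin (Nat.card ι + 1)) →₀ ℤ) k))
        (terminal.from (Morphisms.projectiveSpaceInt ι))) d w))
  {ZK : Scheme.{0}} (iK : ZK ⟶ Morphisms.projectiveSpace ι (grassmannianScheme ((Fin d → Fin (Nat.card ι + 1)) →₀ ℤ) k))
  [IsClosedImmersion iK]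
  (hiK : iK.ker = vanishingIdeal (((Scheme.Modules.pullbackPushforwardAdjunction
    (Morphisms.projectiveSpaceFst ι (grassmannianScheme ((Fin d → Fin (Nat.card ι + 1)) →₀ ℤ) k))).homEquiv _ _).symm
    (kernel.ι (universalQuotientπ k ((Fin d → Fin (Nat.card ι + 1)) →₀ ℤ) Finsupp.basisSingleOne) ≫ φGr)))
  (e₀ : ℕ) (R : ℕ → ℕ)
  (hHB2 : ∃ (H : Scheme.{0}) (j : H ⟶ grassmannianScheme ((Fin d → Fin (Nat.card ι + 1)) →₀ ℤ) k), IsImmersion j ∧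
    ∀ ⦃T : Scheme.{0}⦄ [IsLocallyNoetherian T] (g : T ⟶ grassmannianScheme ((Fin d → Fin (Nat.card ι + 1)) →₀ ℤ) k)
      ⦃ZT : Scheme.{0}⦄ (iT : ZT ⟶ Morphisms.projectiveSpace ι T) [IsClosedImmersion iT] (kT : ZT ⟶ ZK)
      (_ : IsPullback kT iT iK (Morphisms.projectiveSpaceMap ι g)),
      (∃! v : T ⟶ H, v ≫ j = g) ↔
        (Flat (iT ≫ Morphisms.projectiveSpaceFst ι T) ∧ ∀ e, e₀ ≤ e → HasRank
          ((Scheme.Modules.pushforward (iT ≫ Morphisms.projectiveSpaceFst ι T)).obj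
            (SerreTwist.twistMod (iT ≫ pullback.snd (terminal.from T) (terminal.from (Morphisms.projectiveSpaceInt ι)))
              (unitModule ZT) e)) (R e)))
  (hcut : ∀ ⦃T Z : Scheme.{0}⦄ [IsLocallyNoetherian T] (i : Z ⟶ Morphisms.projectiveSpace ι T) [IsClosedImmersion i]
    [Flat (i ≫ Morphisms.projectiveSpaceFst ι T)],
    (∀ e, e₀ ≤ e → HasRank ((Scheme.Modules.pushforward (i ≫ Morphisms.projectiveSpaceFst ι T)).obj
      (SerreTwist.twistMod (i ≫ pullback.snd (terminal.from T) (terminal.from (Morphisms.projectiveSpaceInt ι)))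
        (unitModule Z) e)) (R e)) →
    ∀ (ψ : freeModule T (Fin d → Fin (Nat.card ι + 1)) ⟶ (Scheme.Modules.pushforward (i ≫ Morphisms.projectiveSpaceFst ι T)).obj
      (SerreTwist.twistMod (i ≫ pullback.snd (terminal.from T) (terminal.from (Morphisms.projectiveSpaceInt ι))) (unitModule Z) d)),
    (∀ (w : Fin d → Fin (Nat.card ι + 1)) (V : T.Opens), ψ.app V (freeSectionOn T w V) =
      ((Scheme.Modules.pushforward (i ≫ Morphisms.projectiveSpaceFst ι T)).obj
        (SerreTwist.twistMod (i ≫ pullback.snd (terminal.from T) (terminal.from (Morphisms.projectiveSpaceInt ι)))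
          (unitModule Z) d)).presheaf.map (homOfLE (le_top : V ≤ ⊤)).op
        (show Γ((Scheme.Modules.pushforward (i ≫ Morphisms.projectiveSpaceFst ι T)).obj
          (SerreTwist.twistMod (i ≫ pullback.snd (terminal.from T) (terminal.from (Morphisms.projectiveSpaceInt ι)))
            (unitModule Z) d), ⊤) from
          SerreTwist.monomialSection (i ≫ pullback.snd (terminal.from T) (terminal.from (Morphisms.projectiveSpaceInt ι))) d w)) →
    ∀ (φ : freeModule T (Fin d → Fin (Nat.card ι + 1)) ⟶ (Scheme.Modules.pushforward (Morphisms.projectiveSpaceFst ι T)).obj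
      (SerreTwist.twistMod (pullback.snd (terminal.from T) (terminal.from (Morphisms.projectiveSpaceInt ι)))
        (unitModule (Morphisms.projectiveSpace ι T)) d)),
    (∀ (w : Fin d → Fin (Nat.card ι + 1)) (V : T.Opens), φ.app V (freeSectionOn T w V) =
      ((Scheme.Modules.pushforward (Morphisms.projectiveSpaceFst ι T)).obj
        (SerreTwist.twistMod (pullback.snd (terminal.from T) (terminal.from (Morphisms.projectiveSpaceInt ι)))
          (unitModule (Morphisms.projectiveSpace ι T)) d)).presheaf.map (homOfLE (le_top : V ≤ ⊤)).op
        (show Γ((Scheme.Modules.pushforward (Morphisms.projectiveSpaceFst ι T)).obj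
          (SerreTwist.twistMod (pullback.snd (terminal.from T) (terminal.from (Morphisms.projectiveSpaceInt ι)))
            (unitModule (Morphisms.projectiveSpace ι T)) d), ⊤) from
          SerreTwist.monomialSection (pullback.snd (terminal.from T) (terminal.from (Morphisms.projectiveSpaceInt ι))) d w)) →
    i.ker = vanishingIdeal (((Scheme.Modules.pullbackPushforwardAdjunction (Morphisms.projectiveSpaceFst ι T)).homEquiv _ _).symm
      (kernel.ι ψ ≫ φ)))
  (hγ : ∀ ⦃T Z : Scheme.{0}⦄ [IsLocallyNoetherian T] (i : Z ⟶ Morphisms.projectiveSpace ι T) [IsClosedImmersion i]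
    [Flat (i ≫ Morphisms.projectiveSpaceFst ι T)],
    (∀ e, e₀ ≤ e → HasRank ((Scheme.Modules.pushforward (i ≫ Morphisms.projectiveSpaceFst ι T)).obj
      (SerreTwist.twistMod (i ≫ pullback.snd (terminal.from T) (terminal.from (Morphisms.projectiveSpaceInt ι)))
        (unitModule Z) e)) (R e)) →
    ∃ g : T ⟶ grassmannianScheme ((Fin d → Fin (Nat.card ι + 1)) →₀ ℤ) k, ∀ V : T.affineOpens,
      (evalAffine V.2 (pointsEquiv ((Fin d → Fin (Nat.card ι + 1)) →₀ ℤ) k T g)).toSubmodule =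
        LinearMap.ker (sectionsMap (Finsupp.basisSingleOne : Module.Basis (Fin d → Fin (Nat.card ι + 1)) ℤ _)
          ((Scheme.Modules.pushforward (i ≫ Morphisms.projectiveSpaceFst ι T)).obj
            (SerreTwist.twistMod (i ≫ pullback.snd (terminal.from T) (terminal.from (Morphisms.projectiveSpaceInt ι)))
              (unitModule Z) d))
          (fun w => SerreTwist.monomialSection
            (i ≫ pullback.snd (terminal.from T) (terminal.from (Morphisms.projectiveSpaceInt ι))) d w) V))

include hφGr hiK hHB2 hcut hγ in
/-- **(H2′) THE UNIVERSAL FAMILY OF `Hilb ↪ Gr` IS THE BASE CHANGE OF THE UNIVERSAL LOCUS ALONG `j`, AND `j` IS ITS GRASSMANNIAN POINT**: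
the head ★ `exists_universal_flat_family_of` with two more conjuncts on the SAME witnesses `(H, j, Z_H, iH)` — the cartesian square
`Z_H = Z_K ×_{𝐏(ι; Gr)} 𝐏(ι; H)` over `𝐏(j)`, and «`(pointsEquiv j)|_V = ker θ_V(𝒪_{Z_H}(d), μ)` on every affine `V ⊆ H`» (some point `g`
classifies `Z_H` by `hγ`, and `j = g` by ★ `eq_of_isPullback_of_classifies` at the square). [cite: Mumford1966CurvesSurface, Lecture 15 (III.)–(V.) (pp. 106–108)] -/
theorem exists_universal_flat_family_classified_of :
    ∃ (H : Scheme.{0}) (j : H ⟶ grassmannianScheme ((Fin d → Fin (Nat.card ι + 1)) →₀ ℤ) k) (_ : IsImmersion j)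
      (_ : IsLocallyNoetherian H) (ZH : Scheme.{0}) (iH : ZH ⟶ Morphisms.projectiveSpace ι H) (_ : IsClosedImmersion iH)
      (kH : ZH ⟶ ZK) (_ : IsPullback kH iH iK (Morphisms.projectiveSpaceMap ι j)),
      (Flat (iH ≫ Morphisms.projectiveSpaceFst ι H) ∧
        ∀ e, e₀ ≤ e → HasRank ((Scheme.Modules.pushforward (iH ≫ Morphisms.projectiveSpaceFst ι H)).obj
          (SerreTwist.twistMod (iH ≫ pullback.snd (terminal.from H) (terminal.from (Morphisms.projectiveSpaceInt ι)))
            (unitModule ZH) e)) (R e)) ∧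
      (∀ V : H.affineOpens,
        (evalAffine V.2 (pointsEquiv ((Fin d → Fin (Nat.card ι + 1)) →₀ ℤ) k H j)).toSubmodule =
          LinearMap.ker (sectionsMap (Finsupp.basisSingleOne : Module.Basis (Fin d → Fin (Nat.card ι + 1)) ℤ _)
            ((Scheme.Modules.pushforward (iH ≫ Morphisms.projectiveSpaceFst ι H)).obj
              (SerreTwist.twistMod (iH ≫ pullback.snd (terminal.from H) (terminal.from (Morphisms.projectiveSpaceInt ι)))
                (unitModule ZH) d))
            (fun w => SerreTwist.monomialSection
              (iH ≫ pullback.snd (terminal.from H) (terminal.from (Morphisms.projectiveSpaceInt ι))) d w) V)) ∧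
      ∀ ⦃T : Scheme.{0}⦄ [IsLocallyNoetherian T] ⦃Z : Scheme.{0}⦄ (i : Z ⟶ Morphisms.projectiveSpace ι T)
        [IsClosedImmersion i] [Flat (i ≫ Morphisms.projectiveSpaceFst ι T)],
        (∀ e, e₀ ≤ e → HasRank ((Scheme.Modules.pushforward (i ≫ Morphisms.projectiveSpaceFst ι T)).obj
          (SerreTwist.twistMod (i ≫ pullback.snd (terminal.from T) (terminal.from (Morphisms.projectiveSpaceInt ι)))
            (unitModule Z) e)) (R e)) →
        ∃! v : T ⟶ H, ∃ e : Z ⟶ ZH, IsPullback e i iH (Morphisms.projectiveSpaceMap ι v) := by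
  classical
  obtain ⟨H, j, hj, hrep⟩ := hHB2
  haveI := hj
  haveI : IsLocallyNoetherian (grassmannianScheme ((Fin d → Fin (Nat.card ι + 1)) →₀ ℤ) k) :=
    Grassmannian.isLocallyNoetherian _ k
  haveI : IsLocallyNoetherian H := LocallyOfFiniteType.isLocallyNoetherian j
  have HsqH : IsPullback (pullback.fst iK (Morphisms.projectiveSpaceMap ι j)) (pullback.snd iK (Morphisms.projectiveSpaceMap ι j))
      iK (Morphisms.projectiveSpaceMap ι j) := IsPullback.of_hasPullback _ _
  obtain ⟨hflatH, hrkH⟩ := (hrep j (pullback.snd iK (Morphisms.projectiveSpaceMap ι j))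
    (pullback.fst iK (Morphisms.projectiveSpaceMap ι j)) HsqH).mp
    ⟨𝟙 H, Category.id_comp j, fun v hv => by rw [← cancel_mono j, hv, Category.id_comp]⟩
  haveI := hflatH
  -- `j` classifies the universal family over `H`
  obtain ⟨φH, hφH, -⟩ := exists_monomialMap_projectiveSpace (ι := ι) H d
  obtain ⟨gH, hclH⟩ := hγ (pullback.snd iK (Morphisms.projectiveSpaceMap ι j)) hrkH
  obtain rfl : j = gH :=
    eq_of_isPullback_of_classifies d k φGr hφGr iK hiK gH φH hφH (pullback.snd iK (Morphisms.projectiveSpaceMap ι j)) hclH HsqH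
  refine ⟨H, j, hj, inferInstance, pullback iK (Morphisms.projectiveSpaceMap ι j),
    pullback.snd iK (Morphisms.projectiveSpaceMap ι j), inferInstance, pullback.fst iK (Morphisms.projectiveSpaceMap ι j), HsqH,
    ⟨hflatH, hrkH⟩, hclH, fun T _ Z i _ _ hrk => ?_⟩
  obtain ⟨φT, hφT, hφT'⟩ := exists_monomialMap_projectiveSpace (ι := ι) T d
  obtain ⟨g, hcl⟩ := hγ i hrk
  obtain ⟨e, He⟩ := exists_isPullback_of_classifies d k φGr hφGr iK hiK e₀ R hcut g φT hφT hφT' i hcl hrk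
  obtain ⟨v, hv, hvu⟩ := (hrep g i e He).mpr ⟨inferInstance, hrk⟩
  have hsq2 : Morphisms.projectiveSpaceMap ι g = Morphisms.projectiveSpaceMap ι v ≫ Morphisms.projectiveSpaceMap ι j := by
    rw [← hv]
    exact Literature.AlgebraicGeometry.Modules.projectiveSpaceMap_comp ι v j
  refine ⟨v, ⟨pullback.lift e (i ≫ Morphisms.projectiveSpaceMap ι v) (by rw [Category.assoc, ← hsq2]; exact He.w),
    IsPullback.of_right (by rw [pullback.lift_fst, ← hsq2]; exact He) (pullback.lift_snd _ _ _) HsqH⟩, ?_⟩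
  rintro v' ⟨e', He'⟩
  have Hbig : IsPullback (e' ≫ pullback.fst iK (Morphisms.projectiveSpaceMap ι j)) i iK
      (Morphisms.projectiveSpaceMap ι (v' ≫ j)) := by
    rw [Literature.AlgebraicGeometry.Modules.projectiveSpaceMap_comp ι v' j]
    exact He'.paste_horiz HsqH
  exact hvu v' (eq_of_isPullback_of_classifies d k φGr hφGr iK hiK g φT hφT i hcl Hbig)

end Primed

/-! ## The closed primed head -/

section ClosedPrimed

open Polynomial Literature.Algebra.Homology.LaurentCech CategoryTheory.Abelian

/-- **`Hilb^P_{𝐏(ι)} ↪ Gr` WITH ITS UNIVERSAL FAMILY, CLASSIFIED BY `j`** — ★ ed. 4's `exists_grassmannianImmersion_universal_flat_family`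
plus the conjunct «`j` is the Grassmannian point of `Z_H` through the monomial sections of `𝒪_{Z_H}(d)`» (same assembly: `d := B(P)⁺ + e₁`,
`k := R d`, ★ (ε) letters at `Z_𝒦`, ★ ⑩b, (H2′)). [cite: Mumford1966CurvesSurface, Lecture 15 (III.)–(V.) (pp. 106–108)] -/
theorem exists_grassmannianImmersion_universal_flat_family_classified {ι : Type} (hn : 1 ≤ Nat.card ι) (P : ℚ[X]) (e₁ : ℕ)
    (R : ℕ → ℕ) (hR : ∀ e, e₁ ≤ e → (R e : ℚ) = P.eval (e : ℚ)) :
    ∃ (d k e₀ : ℕ) (_ : 0 < e₀) (_ : e₁ ≤ e₀) (_ : (grassmannianSheaf ((Fin d → Fin (Nat.card ι + 1)) →₀ ℤ) k).obj.IsRepresentable)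
      (H : Scheme.{0}) (j : H ⟶ grassmannianScheme ((Fin d → Fin (Nat.card ι + 1)) →₀ ℤ) k) (_ : IsImmersion j)
      (_ : IsLocallyNoetherian H) (ZH : Scheme.{0}) (iH : ZH ⟶ Morphisms.projectiveSpace ι H) (_ : IsClosedImmersion iH),
      (Flat (iH ≫ Morphisms.projectiveSpaceFst ι H) ∧
        ∀ e, e₀ ≤ e → HasRank ((Scheme.Modules.pushforward (iH ≫ Morphisms.projectiveSpaceFst ι H)).obj
          (SerreTwist.twistMod (iH ≫ pullback.snd (terminal.from H) (terminal.from (Morphisms.projectiveSpaceInt ι)))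
            (unitModule ZH) e)) (R e)) ∧
      (∀ V : H.affineOpens,
        (evalAffine V.2 (pointsEquiv ((Fin d → Fin (Nat.card ι + 1)) →₀ ℤ) k H j)).toSubmodule =
          LinearMap.ker (sectionsMap (Finsupp.basisSingleOne : Module.Basis (Fin d → Fin (Nat.card ι + 1)) ℤ _)
            ((Scheme.Modules.pushforward (iH ≫ Morphisms.projectiveSpaceFst ι H)).obj
              (SerreTwist.twistMod (iH ≫ pullback.snd (terminal.from H) (terminal.from (Morphisms.projectiveSpaceInt ι)))
                (unitModule ZH) d))
            (fun w => SerreTwist.monomialSection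
              (iH ≫ pullback.snd (terminal.from H) (terminal.from (Morphisms.projectiveSpaceInt ι))) d w) V)) ∧
      ∀ ⦃T : Scheme.{0}⦄ [IsLocallyNoetherian T] ⦃Z : Scheme.{0}⦄ (i : Z ⟶ Morphisms.projectiveSpace ι T)
        [IsClosedImmersion i] [Flat (i ≫ Morphisms.projectiveSpaceFst ι T)],
        (∀ e, e₀ ≤ e → HasRank ((Scheme.Modules.pushforward (i ≫ Morphisms.projectiveSpaceFst ι T)).obj
          (SerreTwist.twistMod (i ≫ pullback.snd (terminal.from T) (terminal.from (Morphisms.projectiveSpaceInt ι)))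
            (unitModule Z) e)) (R e)) →
        ∃! v : T ⟶ H, ∃ e : Z ⟶ ZH, IsPullback e i iH (Morphisms.projectiveSpaceMap ι v) := by
  classical
  have hd : regularityBound (preHilbertPoly ℚ (Nat.card ι) 0) 0 (preHilbertPoly ℚ (Nat.card ι) 0 - P) ≤
      (((regularityBound (preHilbertPoly ℚ (Nat.card ι) 0) 0 (preHilbertPoly ℚ (Nat.card ι) 0 - P)).toNat + e₁ : ℕ) : ℤ) := by
    have := Int.self_le_toNat (regularityBound (preHilbertPoly ℚ (Nat.card ι) 0) 0 (preHilbertPoly ℚ (Nat.card ι) 0 - P)); push_cast; omega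
  set d : ℕ := (regularityBound (preHilbertPoly ℚ (Nat.card ι) 0) 0 (preHilbertPoly ℚ (Nat.card ι) 0 - P)).toNat + e₁ with hd_def
  haveI := Grassmannian.isRepresentable_grassmannianSheaf ((Fin d → Fin (Nat.card ι + 1)) →₀ ℤ) (R d)
  haveI := Grassmannian.isNoetherian ((Fin d → Fin (Nat.card ι + 1)) →₀ ℤ) (R d); have hk := hR d (Nat.le_add_left _ _)
  obtain ⟨φGr, hφGr, -⟩ := exists_monomialMap_projectiveSpace (ι := ι) (grassmannianScheme ((Fin d → Fin (Nat.card ι + 1)) →₀ ℤ) (R d)) d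
  obtain ⟨m₀, N, hpack⟩ := Literature.AlgebraicGeometry.Modules.exists_uniform_letters_forall_fieldPoint
    ((vanishingIdeal (((Scheme.Modules.pullbackPushforwardAdjunction
      (Morphisms.projectiveSpaceFst ι (grassmannianScheme ((Fin d → Fin (Nat.card ι + 1)) →₀ ℤ) (R d)))).homEquiv _ _).symm
      (kernel.ι (universalQuotientπ (R d) ((Fin d → Fin (Nat.card ι + 1)) →₀ ℤ) Finsupp.basisSingleOne) ≫ φGr))).subschemeι)
    hn (fun e => (coh_pushforward_twistMod_unitModule _ e).loc) (fun e => (coh_pushforward_twistMod_unitModule _ e).ft)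
  obtain ⟨ρ, hρ, hpoly, hS, hvan⟩ := hpack (max m₀ (max e₁ 1)) (le_max_left _ _)
  have hR' : ∀ e, max m₀ (max e₁ 1) ≤ e → (R e : ℚ) = P.eval (e : ℚ) := fun e he => hR e (by omega)
  have hpoly' : ∀ s, ∃ p : Polynomial ℚ, p.natDegree ≤ max N P.natDegree ∧ ∀ m, (ρ s m : ℚ) = p.eval (m : ℚ) :=
    fun s => by obtain ⟨p, hp, hpm⟩ := hpoly s; exact ⟨p, hp.trans (le_max_left _ _), hpm⟩
  have hd' : regularityBound (preHilbertPoly ℚ (Nat.card ι) 0) 0 (preHilbertPoly ℚ (Nat.card ι) 0 - P) - 1 ≤ (d : ℤ) := by linarith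
  obtain ⟨H, j, hj, hH, ZH, iH, hiH, kH, HsqH, hflat, hclH, huniv⟩ := exists_universal_flat_family_classified_of d (R d) φGr hφGr _
    (Scheme.IdealSheafData.ker_subschemeι _) (max m₀ (max e₁ 1)) R
    (Literature.AlgebraicGeometry.Modules.exists_immersion_factors_iff_flat_and_hasRank' _ P _ _ (le_max_right N P.natDegree) R hR'
      ρ hρ hpoly' hS hvan)
    (fun T Z _ i _ _ hrk ψ hψ φ hφ =>
      ker_eq_vanishingIdeal_transpose_of_flat_of_hasRank_twists i d ψ hψ φ hφ hn P _ R hR' hrk (R d) hk hd)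
    (fun T Z _ i _ _ hrk => (existsUnique_hom_grassmannian_of_hasRank_twists hn i P _ R hR' hrk d (R d) hk hd').exists)
  exact ⟨d, R d, max m₀ (max e₁ 1), by omega, by omega, inferInstance, H, j, hj, hH, ZH, iH, hiH, hflat, hclH, huniv⟩

end ClosedPrimed

/-! ## §2 (F-13 P2b) The Hilbert–Plücker class: `[j^*𝒬_k] = [det p_*𝒪_{Z_H}(d)]` on the Hilbert scheme -/

section PluckerClass

open Polynomial Literature.Algebra.Homology.LaurentCech CategoryTheory.Abelian

/-- **`Hilb^P_{𝐏(ι)} ↪_j Gr` WITH ITS UNIVERSAL FAMILY AND THE HILBERT–PLÜCKER CLASS `[j^*𝒬_k] = [det p_*𝒪_{Z_H}(d)]`** ([FGA 221 §4] /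
[MumfordFogartyKirwan1994] Ch. 0 §5 (c), Prop. 7.4: `j` is the Grassmannian point of `𝒪_H ⊗ Sym^d ↠ p_*𝒪_{Z_H}(d)`, so `j^*𝒬_k ≅ p_*𝒪_{Z_H}(d)`).
Same assembly as ★ ⑦b ED. 4 / §1 (`d := B(P)⁺ + e₁`, `k := R d`), exporting in addition `e₁ ≤ d` and the class identity: the monomial map
`𝒪_H^{(Mon_d)} → p_*𝒪_{Z_H}(d)` is an epimorphism (★ ③b `epi_of_app_freeSectionOn_eq_monomialSection`) classified by `j` (§1's «`j` classifies `Z_H`»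
conjunct), hence `p_*𝒪_{Z_H}(d) ≅ j^*𝒬_k` (★ `Grassmannian.exists_iso_pullback_universalQuotient`), both of rank `k` (★ ③b
`hasRank_pushforward_twistMod_of_hasRank_twists`, ★ `hasRank_pullback_universalQuotient`), and `[det]` is an isomorphism invariant (★ `detClass_eq_of_iso`).
[cite: MumfordFogartyKirwan1994, Ch. 0 §5 (c) (p. 23); Ch. 7 §2 Proposition 7.4 (p. 135)] [cite: Mumford1966CurvesSurface, Lecture 15 (III.)–(V.) (pp. 106–108)]
[cite: GortzWedhorn2020, (8.4) (pp. 213–215)] -/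
theorem exists_grassmannianImmersion_universal_flat_family_detClass {ι : Type} (hn : 1 ≤ Nat.card ι) (P : ℚ[X]) (e₁ : ℕ)
    (R : ℕ → ℕ) (hR : ∀ e, e₁ ≤ e → (R e : ℚ) = P.eval (e : ℚ)) :
    ∃ (d k e₀ : ℕ) (_ : 0 < e₀) (_ : e₁ ≤ e₀) (_ : e₁ ≤ d)
      (_ : regularityBound (preHilbertPoly ℚ (Nat.card ι) 0) 0 (preHilbertPoly ℚ (Nat.card ι) 0 - P) - 1 ≤ (d : ℤ))
      (_ : (grassmannianSheaf ((Fin d → Fin (Nat.card ι + 1)) →₀ ℤ) k).obj.IsRepresentable)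
      (H : Scheme.{0}) (j : H ⟶ grassmannianScheme ((Fin d → Fin (Nat.card ι + 1)) →₀ ℤ) k) (_ : IsImmersion j)
      (_ : IsLocallyNoetherian H) (ZH : Scheme.{0}) (iH : ZH ⟶ Morphisms.projectiveSpace ι H) (_ : IsClosedImmersion iH),
      (Flat (iH ≫ Morphisms.projectiveSpaceFst ι H) ∧
        ∀ e, e₀ ≤ e → HasRank ((Scheme.Modules.pushforward (iH ≫ Morphisms.projectiveSpaceFst ι H)).obj
          (SerreTwist.twistMod (iH ≫ pullback.snd (terminal.from H) (terminal.from (Morphisms.projectiveSpaceInt ι))) (unitModule ZH) e)) (R e)) ∧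
      (∃ (hQ : IsFiniteLocallyFree ((Scheme.Modules.pullback j).obj
            (universalQuotient k ((Fin d → Fin (Nat.card ι + 1)) →₀ ℤ)
              (Finsupp.basisSingleOne : Module.Basis (Fin d → Fin (Nat.card ι + 1)) ℤ _))))
          (hP : IsFiniteLocallyFree ((Scheme.Modules.pushforward (iH ≫ Morphisms.projectiveSpaceFst ι H)).obj
            (SerreTwist.twistMod (iH ≫ pullback.snd (terminal.from H) (terminal.from (Morphisms.projectiveSpaceInt ι))) (unitModule ZH) d))),
          detClass hQ = detClass hP) ∧
      ∀ ⦃T : Scheme.{0}⦄ [IsLocallyNoetherian T] ⦃Z : Scheme.{0}⦄ (i : Z ⟶ Morphisms.projectiveSpace ι T)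
        [IsClosedImmersion i] [Flat (i ≫ Morphisms.projectiveSpaceFst ι T)],
        (∀ e, e₀ ≤ e → HasRank ((Scheme.Modules.pushforward (i ≫ Morphisms.projectiveSpaceFst ι T)).obj
          (SerreTwist.twistMod (i ≫ pullback.snd (terminal.from T) (terminal.from (Morphisms.projectiveSpaceInt ι))) (unitModule Z) e)) (R e)) →
        ∃! v : T ⟶ H, ∃ e : Z ⟶ ZH, IsPullback e i iH (Morphisms.projectiveSpaceMap ι v) := by
  classical
  have hd : regularityBound (preHilbertPoly ℚ (Nat.card ι) 0) 0 (preHilbertPoly ℚ (Nat.card ι) 0 - P) ≤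
      (((regularityBound (preHilbertPoly ℚ (Nat.card ι) 0) 0 (preHilbertPoly ℚ (Nat.card ι) 0 - P)).toNat + e₁ : ℕ) : ℤ) := by
    have := Int.self_le_toNat (regularityBound (preHilbertPoly ℚ (Nat.card ι) 0) 0 (preHilbertPoly ℚ (Nat.card ι) 0 - P)); push_cast; omega
  set d : ℕ := (regularityBound (preHilbertPoly ℚ (Nat.card ι) 0) 0 (preHilbertPoly ℚ (Nat.card ι) 0 - P)).toNat + e₁ with hd_def
  haveI := Grassmannian.isRepresentable_grassmannianSheaf ((Fin d → Fin (Nat.card ι + 1)) →₀ ℤ) (R d)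
  haveI := Grassmannian.isNoetherian ((Fin d → Fin (Nat.card ι + 1)) →₀ ℤ) (R d); have hk := hR d (Nat.le_add_left _ _)
  obtain ⟨φGr, hφGr, -⟩ := exists_monomialMap_projectiveSpace (ι := ι) (grassmannianScheme ((Fin d → Fin (Nat.card ι + 1)) →₀ ℤ) (R d)) d
  obtain ⟨m₀, N, hpack⟩ := Literature.AlgebraicGeometry.Modules.exists_uniform_letters_forall_fieldPoint
    ((vanishingIdeal (((Scheme.Modules.pullbackPushforwardAdjunction
      (Morphisms.projectiveSpaceFst ι (grassmannianScheme ((Fin d → Fin (Nat.card ι + 1)) →₀ ℤ) (R d)))).homEquiv _ _).symm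
      (kernel.ι (universalQuotientπ (R d) ((Fin d → Fin (Nat.card ι + 1)) →₀ ℤ) Finsupp.basisSingleOne) ≫ φGr))).subschemeι)
    hn (fun e => (coh_pushforward_twistMod_unitModule _ e).loc) (fun e => (coh_pushforward_twistMod_unitModule _ e).ft)
  obtain ⟨ρ, hρ, hpoly, hS, hvan⟩ := hpack (max m₀ (max e₁ 1)) (le_max_left _ _)
  have hR' : ∀ e, max m₀ (max e₁ 1) ≤ e → (R e : ℚ) = P.eval (e : ℚ) := fun e he => hR e (by omega)
  have hpoly' : ∀ s, ∃ p : Polynomial ℚ, p.natDegree ≤ max N P.natDegree ∧ ∀ m, (ρ s m : ℚ) = p.eval (m : ℚ) :=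
    fun s => by obtain ⟨p, hp, hpm⟩ := hpoly s; exact ⟨p, hp.trans (le_max_left _ _), hpm⟩
  have hd' : regularityBound (preHilbertPoly ℚ (Nat.card ι) 0) 0 (preHilbertPoly ℚ (Nat.card ι) 0 - P) - 1 ≤ (d : ℤ) := by linarith
  obtain ⟨H, j, hj, hH, ZH, iH, hiH, kH, HsqH, hflat, hclH, huniv⟩ := exists_universal_flat_family_classified_of d (R d) φGr hφGr _
    (Scheme.IdealSheafData.ker_subschemeι _) (max m₀ (max e₁ 1)) R
    (Literature.AlgebraicGeometry.Modules.exists_immersion_factors_iff_flat_and_hasRank' _ P _ _ (le_max_right N P.natDegree) R hR'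
      ρ hρ hpoly' hS hvan)
    (fun T Z _ i _ _ hrk ψ hψ φ hφ =>
      ker_eq_vanishingIdeal_transpose_of_flat_of_hasRank_twists i d ψ hψ φ hφ hn P _ R hR' hrk (R d) hk hd)
    (fun T Z _ i _ _ hrk => (existsUnique_hom_grassmannian_of_hasRank_twists hn i P _ R hR' hrk d (R d) hk hd').exists)
  -- (i) the Hilbert–Plücker class on `H`
  haveI := hiH
  haveI := hH
  obtain ⟨hflatH, hrkH⟩ := hflat
  haveI := hflatH
  obtain ⟨ψH, hψH⟩ := exists_hom_freeModule_app_eq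
    ((Scheme.Modules.pushforward (iH ≫ Morphisms.projectiveSpaceFst ι H)).obj
      (SerreTwist.twistMod (iH ≫ pullback.snd (terminal.from H) (terminal.from (Morphisms.projectiveSpaceInt ι))) (unitModule ZH) d))
    (fun w => show Γ((Scheme.Modules.pushforward (iH ≫ Morphisms.projectiveSpaceFst ι H)).obj
        (SerreTwist.twistMod (iH ≫ pullback.snd (terminal.from H) (terminal.from (Morphisms.projectiveSpaceInt ι)))
          (unitModule ZH) d), ⊤) from
      SerreTwist.monomialSection (iH ≫ pullback.snd (terminal.from H) (terminal.from (Morphisms.projectiveSpaceInt ι))) d w)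
  haveI : Epi ψH := epi_of_app_freeSectionOn_eq_monomialSection hn iH P (max m₀ (max e₁ 1)) R hR' hrkH d (R d) hk hd' ψH hψH
  have hψtop : (fun w => ψH.app ⊤ (freeSectionOn H w ⊤)) = fun w =>
      show Γ((Scheme.Modules.pushforward (iH ≫ Morphisms.projectiveSpaceFst ι H)).obj
        (SerreTwist.twistMod (iH ≫ pullback.snd (terminal.from H) (terminal.from (Morphisms.projectiveSpaceInt ι)))
          (unitModule ZH) d), ⊤) from
      SerreTwist.monomialSection (iH ≫ pullback.snd (terminal.from H) (terminal.from (Morphisms.projectiveSpaceInt ι))) d w := by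
    funext w
    rw [hψH w ⊤, show homOfLE (le_top : (⊤ : H.Opens) ≤ ⊤) = 𝟙 _ from Subsingleton.elim _ _, op_id,
      ((Scheme.Modules.pushforward (iH ≫ Morphisms.projectiveSpaceFst ι H)).obj
        (SerreTwist.twistMod (iH ≫ pullback.snd (terminal.from H) (terminal.from (Morphisms.projectiveSpaceInt ι)))
          (unitModule ZH) d)).presheaf.map_id]
    rfl
  have hfH : ∀ V : H.affineOpens, (evalAffine V.2 (pointsEquiv ((Fin d → Fin (Nat.card ι + 1)) →₀ ℤ) (R d) H j)).toSubmodule =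
      LinearMap.ker (sectionsMap (Finsupp.basisSingleOne : Module.Basis (Fin d → Fin (Nat.card ι + 1)) ℤ _)
        ((Scheme.Modules.pushforward (iH ≫ Morphisms.projectiveSpaceFst ι H)).obj
          (SerreTwist.twistMod (iH ≫ pullback.snd (terminal.from H) (terminal.from (Morphisms.projectiveSpaceInt ι))) (unitModule ZH) d))
        (fun w => ψH.app ⊤ (freeSectionOn H w ⊤)) V) := fun V => by
    rw [hψtop]; exact hclH V
  obtain ⟨-, e, -, -, -⟩ := exists_iso_pullback_universalQuotient (R d) ((Fin d → Fin (Nat.card ι + 1)) →₀ ℤ)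
    (Finsupp.basisSingleOne : Module.Basis (Fin d → Fin (Nat.card ι + 1)) ℤ _) j _ ψH hfH
  have hP : IsFiniteLocallyFree ((Scheme.Modules.pushforward (iH ≫ Morphisms.projectiveSpaceFst ι H)).obj
      (SerreTwist.twistMod (iH ≫ pullback.snd (terminal.from H) (terminal.from (Morphisms.projectiveSpaceInt ι))) (unitModule ZH) d)) :=
    HasRank.isFiniteLocallyFree' (hasRank_pushforward_twistMod_of_hasRank_twists hn iH P (max m₀ (max e₁ 1)) R hR' hrkH d (R d) hk hd')
  have hQ : IsFiniteLocallyFree ((Scheme.Modules.pullback j).obj (universalQuotient (R d) ((Fin d → Fin (Nat.card ι + 1)) →₀ ℤ)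
      (Finsupp.basisSingleOne : Module.Basis (Fin d → Fin (Nat.card ι + 1)) ℤ _))) :=
    HasRank.isFiniteLocallyFree' (hasRank_pullback_universalQuotient (R d) ((Fin d → Fin (Nat.card ι + 1)) →₀ ℤ)
      (Finsupp.basisSingleOne : Module.Basis (Fin d → Fin (Nat.card ι + 1)) ℤ _) j)
  exact ⟨d, R d, max m₀ (max e₁ 1), by omega, by omega, Nat.le_add_left _ _, hd', inferInstance, H, j, hj, hH, ZH, iH, hiH, ⟨hflatH, hrkH⟩,
    ⟨hQ, hP, (detClass_eq_of_iso e hP hQ).symm⟩, huniv⟩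

/-- **HEAD — the letter of the F-13 stub `stub_PLhilbClass` (skeleton v0, shape (β′)), token for token** (`∀ ⦃ι⦄ [Finite ι]`; the
finiteness instance is not used by the proof). [cite: MumfordFogartyKirwan1994, Ch. 0 §5 (c) (p. 23); Ch. 7 §2 Proposition 7.4 (p. 135)]
[cite: Mumford1966CurvesSurface, Lecture 15 (III.)–(V.) (pp. 106–108)] [cite: GortzWedhorn2020, (8.4) (pp. 213–215)] -/
theorem hilbertPluckerClass : ∀ ⦃ι : Type⦄ [Finite ι], 1 ≤ Nat.card ι → ∀ (P : ℚ[X]) (e₁ : ℕ) (R : ℕ → ℕ),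
    (∀ e, e₁ ≤ e → (R e : ℚ) = P.eval (e : ℚ)) →
    ∃ (d k e₀ : ℕ) (_ : 0 < e₀) (_ : e₁ ≤ e₀) (_ : e₁ ≤ d)
      (_ : regularityBound (preHilbertPoly ℚ (Nat.card ι) 0) 0 (preHilbertPoly ℚ (Nat.card ι) 0 - P) - 1 ≤ (d : ℤ))
      (_ : (grassmannianSheaf ((Fin d → Fin (Nat.card ι + 1)) →₀ ℤ) k).obj.IsRepresentable)
      (H : Scheme.{0}) (j : H ⟶ grassmannianScheme ((Fin d → Fin (Nat.card ι + 1)) →₀ ℤ) k) (_ : IsImmersion j)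
      (_ : IsLocallyNoetherian H) (ZH : Scheme.{0}) (iH : ZH ⟶ Morphisms.projectiveSpace ι H) (_ : IsClosedImmersion iH),
      (Flat (iH ≫ Morphisms.projectiveSpaceFst ι H) ∧
        ∀ e, e₀ ≤ e → HasRank ((Scheme.Modules.pushforward (iH ≫ Morphisms.projectiveSpaceFst ι H)).obj
          (SerreTwist.twistMod (iH ≫ pullback.snd (terminal.from H) (terminal.from (Morphisms.projectiveSpaceInt ι))) (unitModule ZH) e)) (R e)) ∧
      (∃ (hQ : IsFiniteLocallyFree ((Scheme.Modules.pullback j).obj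
            (universalQuotient k ((Fin d → Fin (Nat.card ι + 1)) →₀ ℤ)
              (Finsupp.basisSingleOne : Module.Basis (Fin d → Fin (Nat.card ι + 1)) ℤ _))))
          (hP : IsFiniteLocallyFree ((Scheme.Modules.pushforward (iH ≫ Morphisms.projectiveSpaceFst ι H)).obj
            (SerreTwist.twistMod (iH ≫ pullback.snd (terminal.from H) (terminal.from (Morphisms.projectiveSpaceInt ι))) (unitModule ZH) d))),
          detClass hQ = detClass hP) ∧
      ∀ ⦃T : Scheme.{0}⦄ [IsLocallyNoetherian T] ⦃Z : Scheme.{0}⦄ (i : Z ⟶ Morphisms.projectiveSpace ι T)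
        [IsClosedImmersion i] [Flat (i ≫ Morphisms.projectiveSpaceFst ι T)],
        (∀ e, e₀ ≤ e → HasRank ((Scheme.Modules.pushforward (i ≫ Morphisms.projectiveSpaceFst ι T)).obj
          (SerreTwist.twistMod (i ≫ pullback.snd (terminal.from T) (terminal.from (Morphisms.projectiveSpaceInt ι))) (unitModule Z) e)) (R e)) →
        ∃! v : T ⟶ H, ∃ e : Z ⟶ ZH, IsPullback e i iH (Morphisms.projectiveSpaceMap ι v) :=
  fun _ _ hn P e₁ R hR => exists_grassmannianImmersion_universal_flat_family_detClass hn P e₁ R hR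

end PluckerClass

end Literature.AlgebraicGeometry.Motives

end
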